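import Summits.NavierStokesRegularity.NavierStokesRegularity.Theses.HodographBetchov
import HarnessLib.Audit

/-!
# Birth skeleton (BC3) of the crux `HodographBetchov.ClassBudgetsRegularise`

(crux item `stmt-NavierStokesRegularity-16863`, rank 4, route
`route-NavierStokesRegularity-HodographBetchov` (rev 5); tree path
`Cruxes/ClassBudgetsRegularise/Lines/birth.lean`; registrar
`planner-skel-stmt-NavierStokesRegularity-16863-0`, 2026-08-17. The route predates the Lean birth
certificate; this file supplies BC3 retroactively. No `Disproof.lean`, no lines, no ideas exist for
this crux (`ledger crux ls`, 2026-08-17); the negatives index of the summit (4 entries: tangent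
moduli, averaged pump, corrector, Clay non-uniqueness) touches none of the stubs below.)

THE CRUX (fixed, the route's decl — the BETCHOV–MILLER BRIDGE in Clay (A)-form, the deciding
hypothesis of the route's `closes`): for every `ν > 0` and every Clay datum `u₀` (smooth,
divergence free, rapidly decaying): IF along every classical solution `(u, p)` of the unforced
system on `ℝ³ × [0, T)`, every `T > 0`, which is Leray–Hopf from `u 0 = u₀`, SOME speed level
`l > 0` carries both CLASS BUDGETS — (slow) the enstrophy production `ω·(∇u)ω` is integrable on the
slow space-time class `{0 < s < t, |u| ≤ l}` with integral `≤ C` uniformly in `t < T`, and (fast) a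
nonnegative Courant–Fischer majorant `m` of the middle strain eigenvalue on the fast class
`{|u| > l}` lies in a Miller–Serrin class `L^p_t L^q_x`, `2/p + 3/q = 2`, `q > 3/2` — THEN `u₀`
launches a global smooth solution with bounded energy (Fefferman (A) for `u₀`).

THE CUT — the route's own TWO-LAYER PLAN one level down ("ClassBudgetsRegularise ⇐ LocalisedMiller
(per-solution continuation at a common level) + DatumFrame (per-datum no-blow-up ⇒ Clay (A))"),
with the per-solution core `LocalisedMiller` (support item stmt-15833) itself cut at its natural
seam, the ENSTROPHY: Miller's argument (arXiv:1710.05569, Thm. 1.1 = Thm. 5.2 with Lemma 5.1) is an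
`Ḣ¹` a-priori bound followed by `H¹` continuation, and only the first half sees the velocity
classes. Three registered stubs, each a genuine theorem-sized statement over tree declarations:

* `stub_classBudgetEnstrophyBound` [L, OPEN — the load-bearing NEW content; "LocalisedMiller, not
  in print" per both grounder passes on the item] — along a classical Leray–Hopf solution from a
  rapidly decaying datum on `[0, T)`, the two class budgets at ONE level `l > 0` bound the
  enstrophy uniformly on `[0, T)`: `∃ E, ∀ t < T, ∫ ‖∇u(t)‖² ≤ E`. Proof plan (route header /
  card T2): `½ Z' = ∫_slow ω·Sω + ∫_fast ω·Sω − ν‖∇ω‖²`; on the fast class Betchov ON VELOCITY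
  CLASSES (support `VelocityClassBetchov`, from `HodographConditioning` = degree-0 hodograph
  identity) gives `∫_F ω·Sω = −4∫_F det S ≤ 2∫_F m |∇u|²` (Miller's Lemma 5.1
  `−det S ≤ ½ λ₂⁺ |S|²`), then Hölder + Gagliardo–Nirenberg (`θ = 3/(2q) < 1`) + Young:
  `≤ (ν/2)‖∇ω‖² + C_q ‖m 1_F‖_q^p Z`; the slow term enters only through its time integral, bounded
  by `C` uniformly in `t < T`; integral Gronwall: `Z(t) ≤ (Z(0) + 2C) exp(C_q ∫₀ᵀ ‖m 1_F‖_q^p)`.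
  Why it might fail (the item's own): the class split needs the hodograph identity for `u(t)` at
  every `t > 0` (decay `u(t) → 0`, `det ∇u(t) ∈ L¹` — after weak–strong identification with the
  `H^k` solution), and the signed slow term is only time-integrated. Sources: Miller2019
  (arXiv:1710.05569 Thm 1.1, Lemma 5.1), NeustupaPenel2001, Betchov1956, tree fact
  `Literature.Analysis.FluidPDE.Miller2019.middleEigenvalueCriterion` (the global, `l = 0` case).
* `stub_enstrophyContinuation` [M/L, KNOWN — Leray 1934 §§19–22; Robinson–Rodrigo–Sadowski 2016
  Thm. 6.15 (local strong solutions from `H¹` data, lifespan `c ν³ ‖∇u₀‖⁻⁴`) + Thm. 6.10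
  (weak–strong uniqueness) + proof of Thm. 12.3 (restart near `T`, glue)] — a classical
  Leray–Hopf solution from a rapidly decaying datum on `[0, T)` whose enstrophy is bounded on
  `[0, T)` extends as a classical solution past `T`. Tree: exactly the restart-and-glue half of
  `hasSmoothExtensionPast_of_bounded_of_local_H1_theory` (`KNSSTypeIIContinuation.lean`: there the
  `H¹` bound on `[T/2, T)` is first derived from `|u| ≤ M` via the Serrin class `L²L^∞`; here it is
  the hypothesis), over `leray_local_strong_H1` / `LerayLocalStrongH1With`,
  `serrin_weak_strong_uniqueness_holds`, `IsLerayHopfOn.exists_isLerayHopfOn_restart_Ioo`,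
  `IsClassicalNSSolutionOn.glue`; `‖∇u‖_F² ≤ 3‖∇u‖ₒₚ²` converts the bound to `eWeakGradL2Sq`.
* `stub_datumFrame` [L, KNOWN IN TREE — the per-datum local theory] — for a Clay datum `u₀`: if
  every classical Leray–Hopf solution `(u, p)` on every `[0, T)` with `u 0 = u₀` extends smoothly
  past `T`, then `u₀` launches a global smooth solution with bounded energy. This is the shared
  frame `Theorems/NoBlowupToClay.lean` `navierStokesRegularity_of_noBlowup` (stmt-0055, PROVED)
  run for ONE datum — its no-blow-up hypothesis is invoked exactly once, at the grafted solution
  `Ũ` with `Ũ 0 = u₀` (Kato maximal time; `T_max = ∞` ⇒ `clay_solution_of_hasGlobalKatoSolution_holds`;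
  `T_max < ∞` ⇒ Leray graft + `lemarieRieusset_singular_point_of_blowup_holds` contradiction) —
  and was kernel-checked in exactly this per-datum form by grounder-ground-pool-g63-0
  (`clayA_of_noBlowup_datum`, evidence `cand_16863_ClassBudgetsRegularise.lean` on the item,
  lean check rc0 / 0 sorry, 2026-08-16). Not imported here: the frame lives in fact-bearing
  modules (route PROVER NOTES (ii), cone hygiene), and the skeleton must not prove beyond assembly.

`ClassBudgetsRegularise_of : Theses.HodographBetchov.ClassBudgetsRegularise` (the ONLY theorem of
this file concluding the crux; conclusion = the crux BY NAME, no `Prop` hypotheses, `sorry` only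
inside the three declared stubs, which it uses by name) is the real composition
`classBudgetsRegularise_assembly` (sorry-free, pure logic; conclusion = the crux UNFOLDED): fix `ν`,
a Clay datum `u₀` and the budget hypothesis; hand `stub_datumFrame` the per-datum no-blow-up
clause, proved as follows — given a classical Leray–Hopf `(u, p)` on `[0, T)` with `u 0 = u₀`, the
budget hypothesis yields a level `l` with both budgets, `u 0 = u₀` makes the datum rapidly
decaying, `stub_classBudgetEnstrophyBound` bounds the enstrophy on `[0, T)` and
`stub_enstrophyContinuation` extends `u` past `T`. The intermediate
`localisedMiller_assembly : <sig Z> → <sig X> → LocalisedMiller-unfolded` records that stubs 1–2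
ARE the support item `LocalisedMiller` (stmt-15833) cut in two. The CLOSED twins
`ClassBudgetsRegularise_of_hyps : <sig Z> → <sig X> → <sig D> → ClassBudgetsRegularise` and
`LocalisedMiller_of_hyps : <sig Z> → <sig X> → LocalisedMiller` (by name, no placeholder anywhere)
are the registrar's evidence file `bc/ClassBudgetsRegularise_birth_closed.lean` on the crux item.

WHY THIS IS A DECOMPOSITION AND NOT A COSTUME. No stub mentions Clay data AND class budgets
together: stub 1 ends at an enstrophy bound (no continuation, no Clay conclusion), stub 2 starts
from an enstrophy bound (no velocity classes), stub 3 starts from no-blow-up of ONE datum (no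
budgets) — so no stub gives the crux or the summit on its own: the BC3 probes
`stub → ClassBudgetsRegularise` and `stub → NavierStokesRegularity` by
`first | exact? | simpa | aesop` fail for all three (registrar's `bc/probe_*.lean`, quoted in
NOTES.md). Stubs 2 and 3 are known theorems (tree-provable now), stub 1 is the one open piece and
is strictly weaker in kind than the crux (a conditional a-priori estimate for one solution, no
existence theory): the three are owned by different engines (strain-shape algebra + degree theory;
Leray's `H¹` theory; Kato's `L³` theory + Lemarié-Rieusset's singular point).

Disproof used: none exists for this crux (no `Disproof.lean`; 2026-08-17). Negatives index: no stub
is an instance of a refuted statement (FiniteTangentModuli, PerpetualPump.Thesis,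
CorrectorSolvable, BlowupClayNonuniqueness concern tangent flows / averaged equations / corrector
solvability / non-uniqueness — none is used).
-/

noncomputable section

open Set MeasureTheory Filter Topology Function
open scoped ENNReal NNReal InnerProductSpace
open Literature.Analysis.FluidPDE

namespace Summit.NavierStokesRegularity.NavierStokesRegularity.Cruxes.ClassBudgetsRegularise.Birth

set_option linter.unusedVariables false
set_option linter.dupNamespace false

local notation "ℝ³" => EuclideanSpace ℝ (Fin 3)

/-! ### The three registered stubs

Abbreviations used in the docstrings (all written OUT in the signatures, over tree declarations
only): `CLH(ν,T,u,p)` := `IsClassicalNSSolutionOn (Set.Ico 0 T) ν 0 u p ∧ IsLerayHopfOn T ν 0 (u 0) u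
∧ HasRapidSpatialDecay (u 0)` (the hypothesis package of every Clay-side item of the route);
`Slow(u,T,l)` := `∃ C, ∀ t ∈ [0,T), ω·(∇u)ω ∈ L¹{(s,x) : 0 < s < t, ‖u s x‖ ≤ l} ∧ ∫∫ ≤ C`
(verbatim the conclusion of crux `SlowClassProduction` at level `l`); `Fast(u,T,l)` := `∃ q > 3/2,
∃ m ≥ 0` Courant–Fischer majorant of `λ₂(∇u)` on `{l < ‖u t x‖}` with
`∫₀ᵀ (∫_{l<|u|} m^q)^{2/(2q−3)} < ∞` (verbatim the conclusion of crux `FastClassSqueeze` at `l`);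
`Ens(u,T)` := `∃ E, ∀ t ∈ [0,T), ∫⁻ ‖fderiv ℝ (u t) x‖ₑ² ≤ E` (enstrophy bounded on `[0, T)`). -/

/-- **stub 1 — `stub_classBudgetEnstrophyBound` (L; OPEN — the Betchov–Miller enstrophy bound on
velocity classes, the new conditional a-priori estimate).** For `ν, T > 0`, a classical solution
`(u, p)` of the unforced Navier–Stokes system on `ℝ³ × [0, T)` which is Leray–Hopf from its rapidly
decaying datum, and a speed level `l > 0`: `Slow(u,T,l)` and `Fast(u,T,l)` imply `Ens(u,T)` — the
enstrophy `∫ ‖∇u(t)‖²` is bounded uniformly in `t ∈ [0, T)`. (Miller 2019 Thm 1.1 is the case where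
`m` majorises `λ₂⁺` on all of `ℝ³`; here `m` is demanded only on the fast class `{|u| > l}` and the
slow class pays with its time-integrated signed production, via Betchov on velocity classes
`∫ g(u) ω·Sω = −4 ∫ g(u) det S`.) Sources: Miller2019 = arXiv:1710.05569 (Thm 1.1, Lemma 5.1),
NeustupaPenel2001, Betchov1956, EvansGariepy2015 (area formula with multiplicity), route supports
`VelocityClassBetchov` / `HodographConditioning`; why it might fail: hodograph identity at `t > 0`
needs `u(t) → 0`, `det ∇u(t) ∈ L¹`; signed slow term only time-integrated. -/
theorem stub_classBudgetEnstrophyBound :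
    ∀ (ν T : ℝ), 0 < ν → 0 < T → ∀ (u : ℝ → ℝ³ → ℝ³) (p : ℝ → ℝ³ → ℝ),
      IsClassicalNSSolutionOn (Set.Ico 0 T) ν 0 u p → IsLerayHopfOn T ν 0 (u 0) u →
      HasRapidSpatialDecay (u 0) → ∀ l : ℝ, 0 < l →
      (∃ C : ℝ, ∀ t ∈ Set.Ico 0 T,
        MeasureTheory.IntegrableOn (fun z : ℝ × ℝ³ =>
            inner ℝ (curl (u z.1) z.2) (fderiv ℝ (u z.1) z.2 (curl (u z.1) z.2)))
          {z : ℝ × ℝ³ | z.1 ∈ Set.Ioo 0 t ∧ ‖u z.1 z.2‖ ≤ l} ∧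
        ∫ z in {z : ℝ × ℝ³ | z.1 ∈ Set.Ioo 0 t ∧ ‖u z.1 z.2‖ ≤ l},
          inner ℝ (curl (u z.1) z.2) (fderiv ℝ (u z.1) z.2 (curl (u z.1) z.2)) ≤ C) →
      (∃ q : ℝ, 3 / 2 < q ∧ ∃ m : ℝ → ℝ³ → ℝ, (∀ t x, 0 ≤ m t x) ∧
        (∀ t ∈ Set.Ico 0 T, ∀ x, l < ‖u t x‖ → ∃ v w : ℝ³, ‖v‖ = 1 ∧ ‖w‖ = 1 ∧ inner ℝ v w = 0 ∧
          ∀ α β : ℝ, inner ℝ (fderiv ℝ (u t) x (α • v + β • w)) (α • v + β • w)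
            ≤ m t x * (α ^ 2 + β ^ 2)) ∧
        ∫⁻ t in Set.Ioo 0 T, (∫⁻ x in {x : ℝ³ | l < ‖u t x‖}, ENNReal.ofReal (m t x) ^ q)
          ^ (2 / (2 * q - 3)) < ⊤) →
      ∃ E : ℝ, ∀ t ∈ Set.Ico 0 T, ∫⁻ x, ‖fderiv ℝ (u t) x‖ₑ ^ 2 ≤ ENNReal.ofReal E := by
  sorry

/-- **stub 2 — `stub_enstrophyContinuation` (M/L; KNOWN — Leray's `H¹` continuation: enstrophy
controls the lifespan).** For `ν, T > 0` and a classical solution `(u, p)` on `ℝ³ × [0, T)` which is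
Leray–Hopf from its rapidly decaying datum: if the enstrophy is bounded on `[0, T)` (`Ens(u,T)`),
then `u` extends as a classical solution past `T` (`HasSmoothExtensionPast ν 0 u T`). Proof (RRS
2016, proof of Thm. 12.3; tree template `hasSmoothExtensionPast_of_bounded_of_local_H1_theory`):
restart at a good time `s ∈ (T − τ/2, T)` with Leray's local strong solution from `u(s) ∈ H¹`
(lifespan `τ = c ν³/(A² + 1)`, `A ≥ 3E + energy`), identify by weak–strong uniqueness, take the
classical representative (Serrin class `L^∞ H¹ ⊂ L^∞ L⁶`) and glue. Sources: Leray1934 (§§19–22),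
RobinsonRodrigoSadowski2016 (Thms 6.15, 6.10, 8.17, proof of 12.3), CheskidovShvydkoy2010 Thm 2.4;
tree `leray_local_strong_H1`, `serrin_weak_strong_uniqueness_holds`, `IsClassicalNSSolutionOn.glue`. -/
theorem stub_enstrophyContinuation :
    ∀ (ν T : ℝ), 0 < ν → 0 < T → ∀ (u : ℝ → ℝ³ → ℝ³) (p : ℝ → ℝ³ → ℝ),
      IsClassicalNSSolutionOn (Set.Ico 0 T) ν 0 u p → IsLerayHopfOn T ν 0 (u 0) u →
      HasRapidSpatialDecay (u 0) →
      (∃ E : ℝ, ∀ t ∈ Set.Ico 0 T, ∫⁻ x, ‖fderiv ℝ (u t) x‖ₑ ^ 2 ≤ ENNReal.ofReal E) →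
      HasSmoothExtensionPast ν 0 u T := by
  sorry

/-- **stub 3 — `stub_datumFrame` (L; KNOWN IN TREE — the per-datum local theory, Kato's `L³`
theory + Leray's weak solution + Lemarié-Rieusset's singular point).** For `ν > 0` and a Clay datum
`u₀` (smooth, divergence free, rapidly decaying): if every classical solution `(u, p)` of the
unforced system on every `ℝ³ × [0, T)`, `T > 0`, which is Leray–Hopf from `u 0` and has `u 0 = u₀`,
extends smoothly past `T`, then there is a smooth solution on `ℝ³ × [0, ∞)` from `u₀` with bounded
energy (Fefferman (A) for `u₀`). = `Theorems/NoBlowupToClay.lean` `navierStokesRegularity_of_noBlowup`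
(stmt-0055, proved) run for one datum; kernel-checked in this per-datum form by the grounder
candidate `clayA_of_noBlowup_datum` (item evidence, 2026-08-16). Sources: Leray1934, Kato1984
(Thms 1, 4), LemarieRieusset2016 (Thm 15.1 (C), Prop 12.3), ESS2003 (Rem 7.5), Fefferman2000. -/
theorem stub_datumFrame :
    ∀ ν : ℝ, 0 < ν → ∀ u₀ : ℝ³ → ℝ³, ContDiff ℝ (⊤ : ℕ∞) u₀ →
      Literature.Analysis.FluidPDE.NSWave0.IsDivFree u₀ → HasRapidSpatialDecay u₀ →
      (∀ T : ℝ, 0 < T → ∀ (u : ℝ → ℝ³ → ℝ³) (p : ℝ → ℝ³ → ℝ),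
        IsClassicalNSSolutionOn (Set.Ico 0 T) ν 0 u p → IsLerayHopfOn T ν 0 (u 0) u → u 0 = u₀ →
        HasSmoothExtensionPast ν 0 u T) →
      ∃ (u : ℝ → ℝ³ → ℝ³) (p : ℝ → ℝ³ → ℝ),
        IsSmoothOnHalfSpace u ∧ IsSmoothOnHalfSpace p ∧ IsNavierStokesSolution ν 0 u₀ u p ∧
          HasBoundedEnergy u := by
  sorry

/-! ### The assemblies (sorry-free) and the skeleton theorem -/

/-- **Per-solution assembly** (pure logic): stubs 1–2 give the route's support item
`LocalisedMiller` (stmt-15833), stated here UNFOLDED (the by-name twin `LocalisedMiller_of_hyps` is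
in the registrar's closed evidence file): at level `l`, the class budgets bound the enstrophy
(stub 1) and bounded enstrophy continues the solution (stub 2). [folklore] -/
theorem localisedMiller_assembly
    (hZ : ∀ (ν T : ℝ), 0 < ν → 0 < T → ∀ (u : ℝ → ℝ³ → ℝ³) (p : ℝ → ℝ³ → ℝ),
      IsClassicalNSSolutionOn (Set.Ico 0 T) ν 0 u p → IsLerayHopfOn T ν 0 (u 0) u →
      HasRapidSpatialDecay (u 0) → ∀ l : ℝ, 0 < l →
      (∃ C : ℝ, ∀ t ∈ Set.Ico 0 T,
        MeasureTheory.IntegrableOn (fun z : ℝ × ℝ³ =>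
            inner ℝ (curl (u z.1) z.2) (fderiv ℝ (u z.1) z.2 (curl (u z.1) z.2)))
          {z : ℝ × ℝ³ | z.1 ∈ Set.Ioo 0 t ∧ ‖u z.1 z.2‖ ≤ l} ∧
        ∫ z in {z : ℝ × ℝ³ | z.1 ∈ Set.Ioo 0 t ∧ ‖u z.1 z.2‖ ≤ l},
          inner ℝ (curl (u z.1) z.2) (fderiv ℝ (u z.1) z.2 (curl (u z.1) z.2)) ≤ C) →
      (∃ q : ℝ, 3 / 2 < q ∧ ∃ m : ℝ → ℝ³ → ℝ, (∀ t x, 0 ≤ m t x) ∧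
        (∀ t ∈ Set.Ico 0 T, ∀ x, l < ‖u t x‖ → ∃ v w : ℝ³, ‖v‖ = 1 ∧ ‖w‖ = 1 ∧ inner ℝ v w = 0 ∧
          ∀ α β : ℝ, inner ℝ (fderiv ℝ (u t) x (α • v + β • w)) (α • v + β • w)
            ≤ m t x * (α ^ 2 + β ^ 2)) ∧
        ∫⁻ t in Set.Ioo 0 T, (∫⁻ x in {x : ℝ³ | l < ‖u t x‖}, ENNReal.ofReal (m t x) ^ q)
          ^ (2 / (2 * q - 3)) < ⊤) →
      ∃ E : ℝ, ∀ t ∈ Set.Ico 0 T, ∫⁻ x, ‖fderiv ℝ (u t) x‖ₑ ^ 2 ≤ ENNReal.ofReal E)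
    (hX : ∀ (ν T : ℝ), 0 < ν → 0 < T → ∀ (u : ℝ → ℝ³ → ℝ³) (p : ℝ → ℝ³ → ℝ),
      IsClassicalNSSolutionOn (Set.Ico 0 T) ν 0 u p → IsLerayHopfOn T ν 0 (u 0) u →
      HasRapidSpatialDecay (u 0) →
      (∃ E : ℝ, ∀ t ∈ Set.Ico 0 T, ∫⁻ x, ‖fderiv ℝ (u t) x‖ₑ ^ 2 ≤ ENNReal.ofReal E) →
      HasSmoothExtensionPast ν 0 u T) :
    ∀ (ν T : ℝ), 0 < ν → 0 < T → ∀ (u : ℝ → ℝ³ → ℝ³) (p : ℝ → ℝ³ → ℝ),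
      IsClassicalNSSolutionOn (Set.Ico 0 T) ν 0 u p → IsLerayHopfOn T ν 0 (u 0) u →
      HasRapidSpatialDecay (u 0) → ∀ l : ℝ, 0 < l →
      (∃ C : ℝ, ∀ t ∈ Set.Ico 0 T,
        MeasureTheory.IntegrableOn (fun z : ℝ × ℝ³ =>
            inner ℝ (curl (u z.1) z.2) (fderiv ℝ (u z.1) z.2 (curl (u z.1) z.2)))
          {z : ℝ × ℝ³ | z.1 ∈ Set.Ioo 0 t ∧ ‖u z.1 z.2‖ ≤ l} ∧
        ∫ z in {z : ℝ × ℝ³ | z.1 ∈ Set.Ioo 0 t ∧ ‖u z.1 z.2‖ ≤ l},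
          inner ℝ (curl (u z.1) z.2) (fderiv ℝ (u z.1) z.2 (curl (u z.1) z.2)) ≤ C) →
      (∃ q : ℝ, 3 / 2 < q ∧ ∃ m : ℝ → ℝ³ → ℝ, (∀ t x, 0 ≤ m t x) ∧
        (∀ t ∈ Set.Ico 0 T, ∀ x, l < ‖u t x‖ → ∃ v w : ℝ³, ‖v‖ = 1 ∧ ‖w‖ = 1 ∧ inner ℝ v w = 0 ∧
          ∀ α β : ℝ, inner ℝ (fderiv ℝ (u t) x (α • v + β • w)) (α • v + β • w)
            ≤ m t x * (α ^ 2 + β ^ 2)) ∧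
        ∫⁻ t in Set.Ioo 0 T, (∫⁻ x in {x : ℝ³ | l < ‖u t x‖}, ENNReal.ofReal (m t x) ^ q)
          ^ (2 / (2 * q - 3)) < ⊤) →
      HasSmoothExtensionPast ν 0 u T := by
  intro ν T hν hT u p hcl hLH hdec l hl hslow hfast
  exact hX ν T hν hT u p hcl hLH hdec (hZ ν T hν hT u p hcl hLH hdec l hl hslow hfast)

/-- **Crux assembly, closed form** (pure logic; the conclusion is the crux UNFOLDED, so that
`ClassBudgetsRegularise_of` below is the only theorem of the file concluding the crux by name): fix
`ν`, a Clay datum `u₀` and the budget hypothesis; the per-datum frame (stub 3) needs the smooth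
extension of every classical Leray–Hopf `(u, p)` on `[0, T)` with `u 0 = u₀` — the budget
hypothesis supplies a level `l` with both budgets, `u 0 = u₀` makes the datum rapidly decaying, and
the per-solution assembly (stubs 1–2) extends `u` past `T`. [folklore] -/
theorem classBudgetsRegularise_assembly
    (hZ : ∀ (ν T : ℝ), 0 < ν → 0 < T → ∀ (u : ℝ → ℝ³ → ℝ³) (p : ℝ → ℝ³ → ℝ),
      IsClassicalNSSolutionOn (Set.Ico 0 T) ν 0 u p → IsLerayHopfOn T ν 0 (u 0) u →
      HasRapidSpatialDecay (u 0) → ∀ l : ℝ, 0 < l →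
      (∃ C : ℝ, ∀ t ∈ Set.Ico 0 T,
        MeasureTheory.IntegrableOn (fun z : ℝ × ℝ³ =>
            inner ℝ (curl (u z.1) z.2) (fderiv ℝ (u z.1) z.2 (curl (u z.1) z.2)))
          {z : ℝ × ℝ³ | z.1 ∈ Set.Ioo 0 t ∧ ‖u z.1 z.2‖ ≤ l} ∧
        ∫ z in {z : ℝ × ℝ³ | z.1 ∈ Set.Ioo 0 t ∧ ‖u z.1 z.2‖ ≤ l},
          inner ℝ (curl (u z.1) z.2) (fderiv ℝ (u z.1) z.2 (curl (u z.1) z.2)) ≤ C) →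
      (∃ q : ℝ, 3 / 2 < q ∧ ∃ m : ℝ → ℝ³ → ℝ, (∀ t x, 0 ≤ m t x) ∧
        (∀ t ∈ Set.Ico 0 T, ∀ x, l < ‖u t x‖ → ∃ v w : ℝ³, ‖v‖ = 1 ∧ ‖w‖ = 1 ∧ inner ℝ v w = 0 ∧
          ∀ α β : ℝ, inner ℝ (fderiv ℝ (u t) x (α • v + β • w)) (α • v + β • w)
            ≤ m t x * (α ^ 2 + β ^ 2)) ∧
        ∫⁻ t in Set.Ioo 0 T, (∫⁻ x in {x : ℝ³ | l < ‖u t x‖}, ENNReal.ofReal (m t x) ^ q)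
          ^ (2 / (2 * q - 3)) < ⊤) →
      ∃ E : ℝ, ∀ t ∈ Set.Ico 0 T, ∫⁻ x, ‖fderiv ℝ (u t) x‖ₑ ^ 2 ≤ ENNReal.ofReal E)
    (hX : ∀ (ν T : ℝ), 0 < ν → 0 < T → ∀ (u : ℝ → ℝ³ → ℝ³) (p : ℝ → ℝ³ → ℝ),
      IsClassicalNSSolutionOn (Set.Ico 0 T) ν 0 u p → IsLerayHopfOn T ν 0 (u 0) u →
      HasRapidSpatialDecay (u 0) →
      (∃ E : ℝ, ∀ t ∈ Set.Ico 0 T, ∫⁻ x, ‖fderiv ℝ (u t) x‖ₑ ^ 2 ≤ ENNReal.ofReal E) →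
      HasSmoothExtensionPast ν 0 u T)
    (hD : ∀ ν : ℝ, 0 < ν → ∀ u₀ : ℝ³ → ℝ³, ContDiff ℝ (⊤ : ℕ∞) u₀ →
      Literature.Analysis.FluidPDE.NSWave0.IsDivFree u₀ → HasRapidSpatialDecay u₀ →
      (∀ T : ℝ, 0 < T → ∀ (u : ℝ → ℝ³ → ℝ³) (p : ℝ → ℝ³ → ℝ),
        IsClassicalNSSolutionOn (Set.Ico 0 T) ν 0 u p → IsLerayHopfOn T ν 0 (u 0) u → u 0 = u₀ →
        HasSmoothExtensionPast ν 0 u T) →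
      ∃ (u : ℝ → ℝ³ → ℝ³) (p : ℝ → ℝ³ → ℝ),
        IsSmoothOnHalfSpace u ∧ IsSmoothOnHalfSpace p ∧ IsNavierStokesSolution ν 0 u₀ u p ∧
          HasBoundedEnergy u) :
    ∀ ν : ℝ, 0 < ν → ∀ u₀ : ℝ³ → ℝ³, ContDiff ℝ (⊤ : ℕ∞) u₀ →
      Literature.Analysis.FluidPDE.NSWave0.IsDivFree u₀ → HasRapidSpatialDecay u₀ →
      (∀ T : ℝ, 0 < T → ∀ (u : ℝ → ℝ³ → ℝ³) (p : ℝ → ℝ³ → ℝ),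
        IsClassicalNSSolutionOn (Set.Ico 0 T) ν 0 u p → IsLerayHopfOn T ν 0 (u 0) u → u 0 = u₀ →
        ∃ l : ℝ, 0 < l ∧
          (∃ C : ℝ, ∀ t ∈ Set.Ico 0 T,
            MeasureTheory.IntegrableOn (fun z : ℝ × ℝ³ =>
                inner ℝ (curl (u z.1) z.2) (fderiv ℝ (u z.1) z.2 (curl (u z.1) z.2)))
              {z : ℝ × ℝ³ | z.1 ∈ Set.Ioo 0 t ∧ ‖u z.1 z.2‖ ≤ l} ∧
            ∫ z in {z : ℝ × ℝ³ | z.1 ∈ Set.Ioo 0 t ∧ ‖u z.1 z.2‖ ≤ l},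
              inner ℝ (curl (u z.1) z.2) (fderiv ℝ (u z.1) z.2 (curl (u z.1) z.2)) ≤ C) ∧
          (∃ q : ℝ, 3 / 2 < q ∧ ∃ m : ℝ → ℝ³ → ℝ, (∀ t x, 0 ≤ m t x) ∧
            (∀ t ∈ Set.Ico 0 T, ∀ x, l < ‖u t x‖ → ∃ v w : ℝ³,
              ‖v‖ = 1 ∧ ‖w‖ = 1 ∧ inner ℝ v w = 0 ∧
              ∀ α β : ℝ, inner ℝ (fderiv ℝ (u t) x (α • v + β • w)) (α • v + β • w)
                ≤ m t x * (α ^ 2 + β ^ 2)) ∧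
            ∫⁻ t in Set.Ioo 0 T, (∫⁻ x in {x : ℝ³ | l < ‖u t x‖}, ENNReal.ofReal (m t x) ^ q)
              ^ (2 / (2 * q - 3)) < ⊤)) →
      ∃ (u : ℝ → ℝ³ → ℝ³) (p : ℝ → ℝ³ → ℝ),
        IsSmoothOnHalfSpace u ∧ IsSmoothOnHalfSpace p ∧ IsNavierStokesSolution ν 0 u₀ u p ∧
          HasBoundedEnergy u := by
  intro ν hν u₀ hs hd hdec hbud
  refine hD ν hν u₀ hs hd hdec ?_
  intro T hT u p hcl hLH h0
  -- the budget hypothesis supplies ONE level carrying both class budgets along `(u, p)`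
  obtain ⟨l, hl, hslow, hfast⟩ := hbud T hT u p hcl hLH h0
  -- the datum of `u` is the Clay datum, hence rapidly decaying
  have hdec0 : HasRapidSpatialDecay (u 0) := by rw [h0]; exact hdec
  -- stubs 1–2 (= LocalisedMiller at level `l`): enstrophy bound, then continuation past `T`
  exact localisedMiller_assembly hZ hX ν T hν hT u p hcl hLH hdec0 l hl hslow hfast

/-- **Birth composition (the skeleton theorem).** The crux BY NAME from the three registered
stubs, used by name, through the sorry-free assembly `classBudgetsRegularise_assembly` (the crux's
`def` unfolds to the assembly's conclusion, `Iff.rfl`). -/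
theorem ClassBudgetsRegularise_of :
    Summit.NavierStokesRegularity.NavierStokesRegularity.Theses.HodographBetchov.ClassBudgetsRegularise :=
  classBudgetsRegularise_assembly stub_classBudgetEnstrophyBound stub_enstrophyContinuation
    stub_datumFrame

end Summit.NavierStokesRegularity.NavierStokesRegularity.Cruxes.ClassBudgetsRegularise.Birth

end
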